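import Literature.AnabelianGeometry.EtaleTheta.RealificationPfImageWeak
import Literature.AnabelianGeometry.EtaleTheta.RealifiedDivisorMonoidsOfRlfWeak
import Literature.AnabelianGeometry.EtaleTheta.TemperedFrobenioidToyGenuine
import Literature.AlgebraicGeometry.Frobenioids.RealSpanKernel
import HarnessLib

/-!
# [EtTh] Def. 3.6 (ii): a tempered Frobenioid over the WEAK monoid vocabulary at INFINITELY many special-fibre
# components (`Φ₀ = ∏_ℕ ℤ_{≥0}`), over the tree's genuine category vocabulary — non-vacuity witness

S. Mochizuki, *The étale theta function and its Frobenioid-theoretic manifestations*, Publ. RIMS **45** (2009),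
Def. 3.3 (iii) p.73, Prop. 3.2 (i) p.70 (`DIV⁺` of the special fibre of `Z_∞^log` = the product over its
irreducible components), Prop. 3.4 (i) p.74, Def. 3.6 (i)/(ii) pp.76–77 [cite: MochizukiEtTh2009, Def 3.6 p.77];
S. Mochizuki, *The geometry of Frobenioids I* (2008), Def. 2.4 (i) p.47 [cite: MochizukiFrdI2008, Def. 2.4(i) p.47].

abc-iut cell, layer L2, ROW «NV-L2/TemperedFrobenioid-WEAK-∞» (abc-iut-L2-lead gen 4, ROWS #14 R227; seat
abc-iut-L2-d2 gen 4).  Model-construction file (post-freeze class (b): new path, nothing frozen edited), the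
weak-vocabulary sibling of abc-iut-w5-d164's `TemperedFrobenioidToyGenuine.lean` (`Φ₀ = ℤ_{≥0}`, ONE prime):

Cell finding F-L2d2-1: at a tempered covering with infinitely many special-fibre components (`Ÿ`, `Z_∞`) the
divisor monoid `Φ₀(Y) ≅ ∏_J ℤ_{≥0}` is NOT perf-factorial as printed ([FrdI] Def. 2.4 (i)(d) fails — kernel witness
`PerfFactorialProductCounterexample`), so the printed-vocabulary constructor `ofRlfZ` has NO instance there and every
theorem of the strong [EtTh] §3 chain is vacuous at such `Y`; the cell's repair types §3 over `treeMonoidVocabWeak`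
("perf-factorial" := `IsPerfFactorialCof`) and abc-iut-L6-t12's `ofRlfZWeak`.  abc-iut-L6-t12's
`RealifiedDivisorMonoidsOfRlfWeakPiNat` inhabits Def. 3.6 (i) at `Φ₀ = ∏_ℕ ℤ_{≥0}` with TRIVIAL constants
(`B₀ = F₀ = 1`), over which Def. 3.6 (ii)(b) ("`F(A) → (Φ^{bs-fld})^gp(A)` is nonzero") is unsatisfiable.  THIS FILE:

* `WeakPiNat.divisorMonoids` — Def. 3.3 (iii) datum: `Φ₀ := ∏_ℕ ℤ_{≥0}` (countably many special-fibre
  components), `B₀ := ϖ^ℤ` (the constants of the base field modulo units), `div₀(ϖ) := d = (1, 1, 1, …)` (the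
  special fibre, reduced), `F₀ := B₀`, every log-divisor non-cuspidal, over the one-object base;
* `WeakPiNat.realified := ofRlfZWeak divisorMonoids _` (`Φ₀^ℝ = (∏_ℕ ℤ_{≥0})^rlf`, the WEAK realification;
  `ℝ·Φ₀^cnst = ℝ·[d]`, THE `ℝ`-span);
* `WeakPiNat.pfImage Y := im(Φ₀(Y)^pf → Φ₀(Y)^rlf)` (print's "`Φ := Φ₀^pf|_D`"-type choice) and the computation
  **`pfImage_inf_cnstR_eq`: `Φ ∩ ℝ·Φ₀^cnst = ι(⟨d⟩^pf)`** — `⊆`: the `ℝ`-span `ℝ·[d]` is killed by every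
  `ℝ`-linear functional vanishing on `[d]` (`RealificationData.realSpan_le_ker`), in particular by the coordinate
  quotients `pr_j^rlf / pr_0^rlf` (`PiNatRlfWeak.exists_coordRlf`, `IsPerfFactorialWeak.Rlf.map_realSMul`), so an
  element of `Φ` in the span has all coordinates equal and is a root of a power of `d`
  (`PiNatRlfWeak.mem_mrange_map_powersHom_of_forall_eq`); `⊇`: `ℝ·Φ₀^cnst` is root-closed and contains `[d^c]`;
* **`WeakPiNat.genuineTemperedFrobenioid R S : TemperedFrobenioid realified (Discrete PUnit) (treeCatVocab …)`** —
  Def. 3.6 (ii) data over the WEAK monoid vocabulary and the GENUINE category vocabulary: `Φ` group-saturated and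
  `IsPerfFactorialCof` (`PfImageWeak.*`), divisorial monoid on `D`, **(a) `Φ^{bs-fld} = ι(⟨d⟩^pf) ≅ ℚ_{≥0}`
  monoprime**, (b) `div(ϖ) = ι(d)/1`, `ι(d) ≠ 1`.

HONEST LABEL: GENUINE weak/realification/[FrdI] vocabularies; DEGENERATE geometry (one object, no cusps, all
functions constant) — an instantiation witness for the F-L2d2-1 regime, NOT the tempered Frobenioid of a curve.
No statement of either paper is asserted; nothing here bears on [IUTchIII] Cor. 3.12.  Typed ≠ proved.
-/

noncomputable section

namespace Literature.AnabelianGeometry.EtaleTheta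

open CategoryTheory Opposite Literature.AlgebraicGeometry.Frobenioids

namespace WeakPiNat

/-! ### The Def. 3.3 (iii) datum: `Φ₀ = ∏_ℕ ℤ_{≥0}`, `B₀ = ϖ^ℤ`, `div₀(ϖ) = (1, 1, …)` -/

/-- The reduced special fibre `d = (1, 1, 1, …) ∈ ∏_ℕ ℤ_{≥0}` (every irreducible component with multiplicity one).
[cite: MochizukiEtTh2009, Prop 3.2 p.70] -/
def diag : Multiplicative (ℕ → ℕ) := Multiplicative.ofAdd fun _ => 1

/-- The `j`-th coordinate of `d` is `1`. [cite: MochizukiEtTh2009, Prop 3.2 p.70] -/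
theorem eval_diag (j : ℕ) :
    AddMonoidHom.toMultiplicative (Pi.evalAddMonoidHom (fun _ : ℕ => ℕ) j) diag = Multiplicative.ofAdd 1 := by
  have h := PiNatRlfWeak.eval_diag_pow (J := ℕ) j 1
  rwa [pow_one] at h

/-- `d ≠ 0` (the special fibre is a non-zero divisor). [cite: MochizukiEtTh2009, Prop 3.2 p.70] -/
theorem diag_ne_one : diag ≠ 1 := fun h => by
  have h0 := congrArg (fun f : Multiplicative (ℕ → ℕ) => Multiplicative.toAdd f 0) h
  simp only [diag, toAdd_ofAdd, toAdd_one, Pi.zero_apply] at h0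
  exact one_ne_zero h0

/-- The divisor map of the constants: `ϖ^n ↦ d^n`. [cite: MochizukiEtTh2009, Def 3.3 p.73] -/
def divHom : Multiplicative ℤ →* Algebra.GrothendieckGroup (Multiplicative (ℕ → ℕ)) :=
  zpowersHom _ (Algebra.GrothendieckGroup.of diag)

/-- `div₀(ϖ^k) = [d^k]` for `k ≥ 0`. [cite: MochizukiEtTh2009, Def 3.3 p.73] -/
theorem divHom_ofAdd_natCast (k : ℕ) :
    divHom (Multiplicative.ofAdd (k : ℤ)) = Algebra.GrothendieckGroup.of (diag ^ k) := by
  rw [divHom, zpowersHom_apply, toAdd_ofAdd, zpow_natCast, map_pow]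

/-- `div₀(ϖ) = [d]`. [cite: MochizukiEtTh2009, Def 3.3 p.73] -/
theorem divHom_ofAdd_one : divHom (Multiplicative.ofAdd 1) = Algebra.GrothendieckGroup.of diag := by
  rw [divHom, zpowersHom_apply, toAdd_ofAdd, zpow_one]

/-- `gpMap id = id`, pointwise. [folklore] -/
private theorem gpMap_id_apply {M : Type} [CommMonoid M] (x : Algebra.GrothendieckGroup M) :
    gpMap (MonoidHom.id M) x = x :=
  DFunLike.congr_fun (Literature.AlgebraicGeometry.Frobenioids.gpMap_id (M := M)) x

/-- **Def. 3.3 (iii) datum of the F-L2d2-1 shape with GENUINE constants**: `Φ₀ := ∏_ℕ ℤ_{≥0}` (infinitely many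
special-fibre components), `B₀ := ϖ^ℤ ≅ ℤ`, `B₀ → Φ₀^gp := (ϖ^n ↦ d^n)`, `F₀ := B₀` (all functions constant), every
log-divisor non-cuspidal, no cusps, over the one-object base category.  (Reducible, with literal constant
functors, so that `Φ₀(Y)` unfolds to `∏_ℕ ℤ_{≥0}` syntactically.) [cite: MochizukiEtTh2009, Def 3.3 p.73] -/
@[reducible] def divisorMonoids : DivisorMonoids.{0, 0, 0} (Discrete PUnit.{1}) where
  Φ₀ := { obj := fun _ => CommMonCat.of (Multiplicative (ℕ → ℕ)), map := fun _ => 𝟙 _ }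
  B₀ := { obj := fun _ => CommMonCat.of (Multiplicative ℤ), map := fun _ => 𝟙 _ }
  isUnit_B₀ _ b := by
    change IsUnit (M := Multiplicative ℤ) b
    exact Group.isUnit _
  div₀ _ := divHom
  div₀_natural _ b := (gpMap_id_apply (divHom b)).symm
  F₀ _ := ⊤
  F₀_map _ _ _ := trivial
  ncsp₀ _ := ⊤
  csp₀ _ := ⊥
  ncsp₀_map _ _ _ := trivial
  csp₀_map _ x hx := by
    rw [Submonoid.mem_bot] at hx ⊢
    rw [hx, map_one]
  existsUnique_ncsp_csp _ x := by
    refine ⟨(⟨x, trivial⟩, ⟨1, Submonoid.mem_bot.mpr rfl⟩), mul_one x, ?_⟩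
    rintro ⟨a, c⟩ h
    have hc : c.1 = 1 := Submonoid.mem_bot.mp c.2
    have ha : a.1 = x := by
      have h' : a.1 * c.1 = x := h
      rwa [hc, mul_one] at h'
    exact Prod.ext (Subtype.ext ha) (Subtype.ext hc)

/-- **The repaired Prop. 3.4 (i) HOLDS for this datum**: `∏_ℕ ℤ_{≥0}` is weakly perf-factorial with cofinal
perfection (abc-iut-L2-d2's `PiNat.isPerfFactorialCof`), although NOT perf-factorial as printed.
[cite: MochizukiEtTh2009, Prop 3.4 p.74] -/
theorem isPerfFactorialCof_Φ₀ : ∀ Y : (Discrete PUnit.{1})ᵒᵖ, IsPerfFactorialCof (divisorMonoids.Φ₀.obj Y) :=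
  fun _ => PiNat.isPerfFactorialCof ℕ

/-- The Def. 3.6 (i) realified data CONSTRUCTED over the WEAK vocabulary (abc-iut-L6-t12's `ofRlfZWeak`):
`Φ₀^ℝ = (∏_ℕ ℤ_{≥0})^rlf` (weak realification), `B₀^ℤ = ϖ^ℤ`, `ℝ·Φ₀^cnst =` THE `ℝ`-span of `[d]`.
[cite: MochizukiEtTh2009, Def 3.6 p.76] -/
abbrev realified : RealifiedDivisorMonoids (D₀ := Discrete PUnit.{1}) treeMonoidVocabWeak.{0} :=
  RealifiedDivisorMonoids.ofRlfZWeak divisorMonoids isPerfFactorialCof_Φ₀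

/-! ### `Φ := im(Φ₀^pf → Φ₀^rlf)` and `Φ ∩ ℝ·Φ₀^cnst = ι(⟨d⟩^pf)` -/

/-- `Φ(Y) := im(Φ₀(Y)^pf → Φ₀(Y)^rlf) ⊆ Φ^{ℝ-log}(Y)` (the weak realification map).
[cite: MochizukiEtTh2009, Def 3.6 p.76] -/
def pfImage (Y : (Discrete PUnit.{1})ᵒᵖ) : Submonoid (realified.ΦR.obj Y) :=
  MonoidHom.mrange (isPerfFactorialCof_Φ₀ Y).weak.toRealification

/-- The diagonal image `ι(⟨d⟩^pf) ⊆ Φ(Y)`: the classes of the roots `(d^c)^{1/n}` — it will be `Φ^{bs-fld}(Y)`.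
[cite: MochizukiEtTh2009, Def 3.6 p.77] -/
def diagImage (Y : (Discrete PUnit.{1})ᵒᵖ) : Submonoid (realified.ΦR.obj Y) :=
  MonoidHom.mrange ((isPerfFactorialCof_Φ₀ Y).weak.toRealification.comp
    (Perfection.map (powersHom (Multiplicative (ℕ → ℕ)) diag)))

/-- `ι(⟨d⟩^pf) ⊆ Φ`. [cite: MochizukiEtTh2009, Def 3.6 p.77] -/
theorem diagImage_le_pfImage (Y : (Discrete PUnit.{1})ᵒᵖ) : diagImage Y ≤ pfImage Y := by
  rintro _ ⟨a, rfl⟩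
  exact ⟨_, rfl⟩

/-- **`ι(⟨d⟩^pf) ⊆ ℝ·Φ₀^cnst`**: `[ι((d^c)^{1/n})]^n = [ι(d^c)] = ι^gp(div₀(ϖ^c)) ∈ ℝ·Φ₀^cnst` (`Φ₀^cnst ⊆ ℝ·Φ₀^cnst`),
and `ℝ·Φ₀^cnst` is root-closed. [cite: MochizukiEtTh2009, Def 3.6 p.76] -/
theorem of_mem_cnstR_of_mem_diagImage (Y : (Discrete PUnit.{1})ᵒᵖ) {x : realified.ΦR.obj Y}
    (hx : x ∈ diagImage Y) : Algebra.GrothendieckGroup.of x ∈ realified.cnstR Y := by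
  obtain ⟨a, rfl⟩ := hx
  obtain ⟨⟨c, n⟩, rfl⟩ := Perfection.mk_surjective a
  have hM := isPerfFactorialCof_Φ₀ Y
  refine realified.cnstR_root Y _ n ?_
  -- `[ι(d^c)] = ι^gp(div₀(ϖ^c)) ∈ ℝ·Φ₀^cnst` since `Φ₀^cnst ⊆ ℝ·Φ₀^cnst`
  have key := realified.cnst_le_cnstR Y (Multiplicative.ofAdd ((Multiplicative.toAdd c : ℕ) : ℤ))
    (Submonoid.mem_top _)
  have hb : realified.div₀ Y (Multiplicative.ofAdd ((Multiplicative.toAdd c : ℕ) : ℤ)) =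
      Algebra.GrothendieckGroup.of (diag ^ Multiplicative.toAdd c) :=
    divHom_ofAdd_natCast _
  rw [hb] at key
  -- the `n`-th power of the class of `ι((d^c)^{1/n})` is `[ι(d^c)]`
  have e : Algebra.GrothendieckGroup.of ((hM.weak.toRealification.comp
      (Perfection.map (powersHom (Multiplicative (ℕ → ℕ)) diag))) (Perfection.mk c n)) ^ (n : ℕ) =
      EtaleTheta.gpMap (realified.toR Y) (Algebra.GrothendieckGroup.of (diag ^ Multiplicative.toAdd c)) := by
    rw [← map_pow, ← map_pow, Perfection.mk_pow_self, EtaleTheta.gpMap_of]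
    rfl
  exact (congrArg (· ∈ realified.cnstR Y) e).mpr key

/-- `ι^gp(div₀(ϖ^n)) = [ι(d)]^n` in `(Φ₀^ℝ)^gp` (THE weak realification data: `ι^gp = gpMap (Φ₀ → Φ₀^rlf)`).
[cite: MochizukiEtTh2009, Def 3.6 p.76] -/
theorem toRlfGp_divHom (Y : (Discrete PUnit.{1})ᵒᵖ) (b : Multiplicative ℤ) :
    ((RealifiedDivisorMonoids.realDataWeak divisorMonoids isPerfFactorialCof_Φ₀).toRlfGp (unop Y) (divHom b) :
        Algebra.GrothendieckGroup (isPerfFactorialCof_Φ₀ Y).weak.Rlf) =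
      (Algebra.GrothendieckGroup.of ((isPerfFactorialCof_Φ₀ Y).weak.toRealification (Perfection.of _ diag)) :
        Algebra.GrothendieckGroup (isPerfFactorialCof_Φ₀ Y).weak.Rlf) ^ Multiplicative.toAdd b := by
  rw [divHom, zpowersHom_apply, map_zpow,
    show ((RealifiedDivisorMonoids.realDataWeak divisorMonoids isPerfFactorialCof_Φ₀).toRlfGp (unop Y)
        (Algebra.GrothendieckGroup.of diag) : Algebra.GrothendieckGroup (isPerfFactorialCof_Φ₀ Y).weak.Rlf) =
      (Algebra.GrothendieckGroup.of ((isPerfFactorialCof_Φ₀ Y).weak.toRealification (Perfection.of _ diag)) :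
        Algebra.GrothendieckGroup (isPerfFactorialCof_Φ₀ Y).weak.Rlf) from
    MonGp.map_of _ _]
  rfl

/-- **`Φ ∩ ℝ·Φ₀^cnst ⊆ ι(⟨d⟩^pf)`**: if `ι(a) ∈ Φ(Y)` lies in the `ℝ`-span `ℝ·[d]`, then all coordinates of `a`
agree — the span is killed by the `ℝ`-linear functionals `pr_j^rlf / pr_0^rlf` on `(Φ₀^rlf)^gp`, which kill `[d]`
(`RealificationData.realSpan_le_ker`; coordinates `PiNatRlfWeak.exists_coordRlf`, `ℝ`-linearity
`IsPerfFactorialWeak.Rlf.map_realSMul`) — hence `a ∈ ⟨d⟩^pf` (`PiNatRlfWeak.mem_mrange_map_powersHom_of_forall_eq`).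
[cite: MochizukiEtTh2009, Def 3.6 p.77] -/
theorem mem_diagImage_of_mem_cnstR (Y : (Discrete PUnit.{1})ᵒᵖ) {x : realified.ΦR.obj Y} (hx : x ∈ pfImage Y)
    (hc : Algebra.GrothendieckGroup.of x ∈ realified.cnstR Y) : x ∈ diagImage Y := by
  obtain ⟨a, rfl⟩ := hx
  have hM := isPerfFactorialCof_Φ₀ Y
  -- all coordinates of `a` agree with the `0`-th one
  have hcoord : ∀ j : ℕ,
      Perfection.map (AddMonoidHom.toMultiplicative (Pi.evalAddMonoidHom (fun _ : ℕ => ℕ) j)) a =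
        Perfection.map (AddMonoidHom.toMultiplicative (Pi.evalAddMonoidHom (fun _ : ℕ => ℕ) 0)) a := by
    intro j
    obtain ⟨φ, hφ⟩ := PiNatRlfWeak.exists_coordRlf hM j
    obtain ⟨φ₀, hφ₀⟩ := PiNatRlfWeak.exists_coordRlf hM 0
    -- the `ℝ`-linear functional `Dg := pr_j^rlf / pr_0^rlf` on `(Φ₀^rlf)^gp`
    let Dg : Algebra.GrothendieckGroup hM.weak.Rlf →* Algebra.GrothendieckGroup PiNatRlfWeak.natWeak.Rlf :=
      MonGp.map φ / MonGp.map φ₀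
    have hDg : ∀ ξ, Dg ξ = MonGp.map φ ξ / MonGp.map φ₀ ξ := fun _ => rfl
    -- `Dg` kills the image of `d`: `pr_j(d) = 1 = pr_0(d)`
    have hDd : Dg (Algebra.GrothendieckGroup.of (hM.weak.toRealification (Perfection.of _ diag))) = 1 := by
      rw [hDg, MonGp.map_of, MonGp.map_of, PiNatRlfWeak.coordRlf_apply_toRealification hM hφ,
        PiNatRlfWeak.coordRlf_apply_toRealification hM hφ₀, Perfection.of_apply, Perfection.map_mk,
        Perfection.map_mk, eval_diag, eval_diag, div_self']
    have hle : realified.cnstR Y ≤ Dg.ker := by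
      rw [RealifiedDivisorMonoids.ofRlfZWeak_cnstR]
      apply RealificationData.realSpan_le_ker
      · -- the kernel is stable under the scalars `r • (−)` (`ℝ`-linearity of `pr^rlf`)
        change ∀ (r : ℝ) (ξ : Algebra.GrothendieckGroup hM.weak.Rlf), Dg ξ = 1 →
          Dg (IsPerfFactorialWeak.Rlf.realSMul hM.weak r ξ) = 1
        intro r ξ hξ
        rw [hDg, div_eq_one] at hξ
        rw [hDg, IsPerfFactorialWeak.Rlf.map_realSMul, IsPerfFactorialWeak.Rlf.map_realSMul, hξ, div_self']
      · -- `Dg` kills `ι^gp(Φ₀^cnst)`: `Φ₀^cnst` is generated by the `div₀(ϖ^n)`, and `ι^gp(div₀(ϖ^n)) = [ι(d)]^n`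
        let ιgp : Algebra.GrothendieckGroup (divisorMonoids.Φ₀.obj Y) →* Algebra.GrothendieckGroup hM.weak.Rlf :=
          (RealifiedDivisorMonoids.realDataWeak divisorMonoids isPerfFactorialCof_Φ₀).toRlfGp (unop Y)
        change ∀ c, c ∈ divisorMonoids.cnstGp.carrier (unop Y) → (Dg.comp ιgp) c = 1
        intro c hc
        have hsub : (↑(divisorMonoids.cnst (op (unop Y))) : Set (Algebra.GrothendieckGroup (divisorMonoids.Φ₀.obj Y))) ⊆
            ↑(Dg.comp ιgp).ker := by
          rintro _ ⟨b, -, rfl⟩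
          change Dg (ιgp (divHom b)) = 1
          rw [show ιgp (divHom b) = _ from toRlfGp_divHom Y b, map_zpow, hDd, one_zpow]
        exact (Subgroup.closure_le _).mpr hsub hc
    have h1 : Dg (Algebra.GrothendieckGroup.of (hM.weak.toRealification a)) = 1 := hle hc
    rw [hDg, div_eq_one, MonGp.map_of, MonGp.map_of] at h1
    haveI := IsPerfFactorialWeak.Rlf.isCancelMul PiNatRlfWeak.natWeak
    have h2 := Algebra.GrothendieckGroup.of_injective h1
    rw [PiNatRlfWeak.coordRlf_apply_toRealification hM hφ, PiNatRlfWeak.coordRlf_apply_toRealification hM hφ₀] at h2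
    exact PfImageWeak.toRealification_injective _ h2
  obtain ⟨b, hb⟩ := PiNatRlfWeak.mem_mrange_map_powersHom_of_forall_eq 0 a hcoord
  exact ⟨b, congrArg hM.weak.toRealification hb⟩

/-- **`Φ(Y) ∩ ℝ·Φ₀^cnst(Y) = ι(⟨d⟩^pf)`** ("`Φ^{bs-fld}`" at the witness). [cite: MochizukiEtTh2009, Def 3.6 p.77] -/
theorem pfImage_inf_cnstR_eq (Y : (Discrete PUnit.{1})ᵒᵖ) :
    pfImage Y ⊓ (realified.cnstR Y).toSubmonoid.comap Algebra.GrothendieckGroup.of = diagImage Y := by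
  refine le_antisymm (fun x hx => mem_diagImage_of_mem_cnstR Y hx.1 hx.2) fun x hx => ⟨diagImage_le_pfImage Y hx, ?_⟩
  exact of_mem_cnstR_of_mem_diagImage Y hx

/-- `Φ^{bs-fld}(Y) = ι(⟨d⟩^pf) ≅ (ℤ_{≥0})^pf ≅ ℚ_{≥0}` is monoprime. [cite: MochizukiEtTh2009, Def 3.6 p.77] -/
theorem isMonoprime_bsFld (Y : (Discrete PUnit.{1})ᵒᵖ) :
    IsMonoprime ↥(pfImage Y ⊓ (realified.cnstR Y).toSubmonoid.comap Algebra.GrothendieckGroup.of) := by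
  rw [pfImage_inf_cnstR_eq]
  exact PiNatRlfWeak.isMonoprime_mrange_toRealification_comp_map_powersHom (isPerfFactorialCof_Φ₀ Y) 0

/-- `ι(d) ≠ 1` in `Φ₀^ℝ(Y)` (`Φ₀^pf ↪ Φ₀^rlf`, `Φ₀` sharp). [cite: MochizukiEtTh2009, Def 3.6 p.77] -/
theorem toRealification_of_diag_ne_one (Y : (Discrete PUnit.{1})ᵒᵖ) :
    (isPerfFactorialCof_Φ₀ Y).weak.toRealification (Perfection.of _ diag) ≠ 1 := by
  intro h
  have h1 := PfImageWeak.toRealification_injective (isPerfFactorialCof_Φ₀ Y).weak (h.trans (map_one _).symm)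
  rw [Perfection.of_apply, Perfection.mk_eq_one_iff_of_isSharp PiNat.isSharp] at h1
  exact diag_ne_one h1

/-! ### The divisor monoid as a subfunctor and the tempered Frobenioid -/

/-- `Φ ⊆ Φ^{ℝ-log} := Φ₀^ℝ|_D` over the identity base functor: `A ↦ im(Φ₀^pf → Φ₀^rlf)`, stable under pull-back
(`Φ₀(f)^rlf ∘ ι = ι ∘ Φ₀(f)^pf`, `rlfMapWeak_comp_toRealification`). [cite: MochizukiEtTh2009, Def 3.6 p.76] -/
def genuineΦ : SubMonoidOn ((𝟭 (Discrete PUnit.{1})).op ⋙ realified.ΦR) where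
  carrier A := pfImage A
  map_mem := by
    rintro A B f _ ⟨a, rfl⟩
    refine ⟨Perfection.map (divisorMonoids.Φ₀.map f).hom a, ?_⟩
    have h := DFunLike.congr_fun (rlfMapWeak_comp_toRealification divisorMonoids.Φ₀ isPerfFactorialCof_Φ₀ f) a
    simp only [MonoidHom.comp_apply] at h
    exact h.symm

/-- `Φ(A)` is `pfImage A`. [cite: MochizukiEtTh2009, Def 3.6 p.76] -/
@[simp] theorem genuineΦ_carrier (A : (Discrete PUnit.{1})ᵒᵖ) : genuineΦ.carrier A = pfImage A := rfl

variable (R S : ((Discrete PUnit.{1})ᵒᵖ ⥤ CommMonCat.{0}) → Prop)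

/-- **Def. 3.6 (ii) data over the WEAK monoid vocabulary at infinitely many special-fibre components** — the
tempered Frobenioid structure on `(D := Discrete PUnit → D₀, Φ := im(Φ₀^pf → Φ₀^rlf))` over
`ofRlfZWeak WeakPiNat.divisorMonoids _` and the GENUINE category vocabulary `treeCatVocab`: `D` connected and totally
epimorphic; `Φ` group-saturated in `Φ^{ℝ-log}` (`PfImageWeak.isGroupSaturated_mrange_toRealification`) and
"perf-factorial" = `IsPerfFactorialCof` (`PfImageWeak.isPerfFactorialCof_mrange_toRealification`); a divisorial monoid
on `D` (`IsMonoidOn` ∧ objectwise divisorial); (a) `Φ^{bs-fld} = ι(⟨d⟩^pf)` monoprime (`isMonoprime_bsFld`); (b)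
`ϖ ∈ F₀` has divisor `ι(d)/1`, `ι(d) ≠ 1`.  `R`, `S` = the [FrdI] Def. 4.5 predicates, parameters as in `treeCatVocab`.
[cite: MochizukiEtTh2009, Def 3.6 p.77] -/
def genuineTemperedFrobenioid :
    TemperedFrobenioid realified (Discrete PUnit.{1}) (treeCatVocab (Discrete PUnit.{1}) R S) where
  isConnected := Toy.temperedFrobenioid.isConnected
  isTotallyEpimorphic := Toy.temperedFrobenioid.isTotallyEpimorphic
  base := 𝟭 _
  Φ := genuineΦ
  isGroupSaturated A := PfImageWeak.isGroupSaturated_mrange_toRealification (isPerfFactorialCof_Φ₀ A).weak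
  isPerfFactorial A := PfImageWeak.isPerfFactorialCof_mrange_toRealification (isPerfFactorialCof_Φ₀ A)
  isDivisorialOn := by
    rw [treeCatVocab_isDivisorialOn]
    exact ⟨Cor38Toy.isMonoidOn_of_punit _,
      fun A => PfImageWeak.isDivisorial_mrange_toRealification (isPerfFactorialCof_Φ₀ (op A))⟩
  isMonoprime_bsFld A := isMonoprime_bsFld A
  exists_FΛ_div_ne A := by
    refine ⟨Multiplicative.ofAdd (1 : ℤ), Submonoid.mem_top _,
      (isPerfFactorialCof_Φ₀ A).weak.toRealification (Perfection.of _ diag), ⟨_, rfl⟩, 1, one_mem _,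
      toRealification_of_diag_ne_one A, ?_⟩
    rw [RealifiedDivisorMonoids.ofRlfZWeak_divΛ_apply, map_one, div_one]
    change EtaleTheta.gpMap _ (divHom (Multiplicative.ofAdd (1 : ℤ))) = _
    rw [divHom_ofAdd_one, EtaleTheta.gpMap_of]
    rfl

/-- `Φ` of the witness is `pfImage`. [cite: MochizukiEtTh2009, Def 3.6 p.77] -/
@[simp] theorem genuineTemperedFrobenioid_Φ_carrier (A : (Discrete PUnit.{1})ᵒᵖ) :
    (genuineTemperedFrobenioid R S).Φ.carrier A = pfImage A := rfl

/-- The base functor of the witness is the identity. [cite: MochizukiEtTh2009, Def 3.6 p.77] -/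
@[simp] theorem genuineTemperedFrobenioid_base : (genuineTemperedFrobenioid R S).base = 𝟭 _ := rfl

/-- **Def. 3.6 (ii) over the WEAK vocabulary is INHABITED at `Φ₀ = ∏_ℕ ℤ_{≥0}`** — where the printed-vocabulary
interface stack is EMPTY (`OfRlfWeakPiNat.isEmpty_ofRlfZ_hypothesis_piNat`). [cite: MochizukiEtTh2009, Def 3.6 p.77] -/
theorem nonempty_temperedFrobenioid_weak_piNat :
    Nonempty (TemperedFrobenioid realified (Discrete PUnit.{1}) (treeCatVocab (Discrete PUnit.{1}) R S)) :=
  ⟨genuineTemperedFrobenioid R S⟩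

end WeakPiNat

end Literature.AnabelianGeometry.EtaleTheta

end
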